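import Summits.QuantumFields.YangMills.Theorems.IR.TensionRatioDefs
import Literature.MathematicalPhysics.QuantumFieldTheory.LatticeGaugeTorusAreaLaw
import HarnessLib

/-!
# Crux `IR` (stmt-QuantumFields-19354), line `tension-ratio`: the strong-coupling RUNG T1-sc PROVED —
`stub_rung_tensionStrongCoupling_proved : TensionStrongCoupling`

Helper module for item `stmt-QuantumFields-19354` (`--supports … --as helper`): the registered rung stub
`TensionRatio.stub_rung_tensionStrongCoupling : TensionStrongCoupling` of the skeleton `Cruxes/IR/Lines/ym_ir7_tension_ratio.lean`
(statement = tree constant of `Theorems/IR/TensionRatioDefs.lean`, p589073) closes by `exact stub_rung_tensionStrongCoupling_proved`.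

**Statement.** For every compact group `G` carrying a faithful continuous unitary lattice representation `r` (here: every compact
simple simply-connected Lie group, but simplicity and simple connectivity are not used), every continuous matrix representation `π`
that is CENTRE-CHARGED (`π z = ω·1` for some central `z` and `ω ≠ 1`, `0 < dim π`), there is `β_D > 0` such that for
`0 < β ≤ β_D` ONE pair `(C, s)`, `s > 0`, gives the torus area law `|⟨W^π_{R×T}⟩_{(ℤ/(2S+1))⁴, β}| ≤ C^{2(R+T)} e^{−s RT}` for
all `1 ≤ R, T ≤ S`, on EVERY torus `S` (`TorusAreaLaw r.ρ χ_π β S C s`).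

**Proof.** The tree's torus version of the Osterwalder–Seiler strong-coupling cluster expansion
(`Literature/MathematicalPhysics/QuantumFieldTheory/LatticeGaugeTorusAreaLaw.lean`, `StrongCouplingTorusSystem.lean`,
`StrongCouplingPolymerSystem.lean`: the torus plaquette system `torusSystem r.ρ L`, its polymer representation `expect_eq_sum`,
Dobrushin ratio bounds `norm_ratio_le`, activity bounds `norm_aPol_le` on the strong-coupling disc `β ≤ β₁ = betaOne 4 r.ρ`, and the
`N`-ality selection rule by the cyclic SLAB centre twist `twist_rectangle_slab` ∕ `plaquetteHolonomy_torusSigma_twist_slab` ∕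
`mul_le_card_of_forall_meets_tflat`) is stated there for `G = SU(N)` in its defining representation (`IsSpecialUnitaryModel`).  The
three places where `SU(N)` enters are generalised here, the rest is imported BY NAME:
(1) the centre element: instead of `IsSpecialUnitaryModel.exists_central` the centre-charged `π` and `(z, ω)` are hypotheses
(`integral_zdWilsonLoop_mul_eq_zero_of_central`, `aPol_zdWilsonLoop_eq_zero_of_central`) — the ACTION is in the representation
`r.ρ` (any continuous `ρ`), the LOOP in the representation `π`, and the twist argument only needs that the plaquette costs are
blind to a central twist off the two flats while `tr π` of the loop picks up `ω`;
(2) the loop bound: `|W^π| ≤ M` from continuity of `χ_π = (1/N) Re tr π` on the compact group (`π` need not be unitary), carried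
as a factor `M` (`norm_expect_zdWilsonLoop_le_of_central`);
(3) second countability of `G` from the faithful representation `r` (closed embedding into matrices).
The torus side conditions of the tree (`2R + 1 ≤ L`, `R + T < L`) hold for `L = 2S + 1`, `R, T ≤ S`
(`abs_wilsonExpectation_wilsonLoop_le_of_central`), and `torusRect r.ρ χ_π β S R T` is that torus expectation
(`torusRect_eq_wilsonExpectation`).  Constants: `β_D = β₁/2`, `s = log 2` (from `(β/β₁)^{RT} ≤ 2^{−RT}`), `C = M·(2e^{1/2})^{256}`.

HONEST FRAMING: a FORMAT rung inside the known (strong-coupling) regime of crux `IR` — the torus area law of Osterwalder–Seiler 1978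
§5 for centre-charged loops; it says nothing at weak coupling, is not a BC5 witness of weakness, and the YM mass gap (Clay) is NOT
proved by any of this (the line's loads `TensionFloor`, `RatioFloorSC` stay OPEN).

Refs: K. Osterwalder, E. Seiler, Ann. Phys. 110 (1978) 440, §3, §5 (Thm. 5.1, Lemma 5.2); E. Seiler, LNP 159 (1982) Ch. 2–3; tree files
named above (proofs of (1)–(2) adapted line by line from `TorusAreaLaw.integral_zdWilsonLoop_mul_eq_zero_of_twist`,
`TorusAreaLaw.aPol_zdWilsonLoop_eq_zero`, `TorusAreaLaw.norm_expect_zdWilsonLoop_le`, `TorusAreaLaw.abs_wilsonExpectation_wilsonLoop_le`).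
-/

set_option autoImplicit false

noncomputable section

open MeasureTheory Filter Topology Finset
open Literature.MathematicalPhysics Literature.MathematicalPhysics.QuantumFieldTheory
open Literature.MathematicalPhysics.QuantumFieldTheory.AreaLaw
  (twist continuous_rectangle continuous_zdWilsonLoop dependsOn_zdWilsonLoop loopEdges card_loopEdges_le integral_zdHaar_comp_twist)
open Literature.MathematicalPhysics.QuantumFieldTheory.TorusAreaLaw
  (slabSet tflat mul_le_card_of_forall_meets_tflat plaquetteHolonomy_torusSigma_twist_slab twist_rectangle_slab
    measurable_prod_weight abs_prod_weight_le weightProd_torusSystem_ofReal image_torusRed_loopEdges card_plaqSeedsOf_le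
    zdWilsonLoop_comp_torusRed)

namespace Summit.QuantumFields.YangMills.Cruxes.IR.TensionRatio

/-! ## §1 The `N`-ality selection rule for a centre-charged loop representation (action in any representation) -/

section Central

variable {d N Nπ : ℕ} {G : Type*} [Group G] [TopologicalSpace G] [IsTopologicalGroup G] [CompactSpace G]
  [MeasurableSpace G] [BorelSpace G]
  (ρ : G →* Matrix (Fin N) (Fin N) ℂ) (π : G →* Matrix (Fin Nπ) (Fin Nπ) ℂ)

/-- **`N`-ality selection rule for a centre-charged `π`** (Osterwalder–Seiler 1978 §5; the tree's
`TorusAreaLaw.integral_zdWilsonLoop_mul_eq_zero_of_twist` with the centre element as a hypothesis): if `π z = ω·1` with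
`ω ≠ 1`, the twist along `H` by `z` multiplies the rectangular holonomy by `z` (this is where centrality of `z` enters, through
`hH`), and `Φ` is a bounded measurable function invariant under that twist, then `∫ W^π_{R×T} Φ dg_∞ = 0`. -/
theorem integral_zdWilsonLoop_mul_eq_zero_of_central [SecondCountableTopology G] (hπ : Continuous π)
    {z : G} {ω : ℂ} (hω : ω ≠ 1) (hπz : π z = ω • (1 : Matrix (Fin Nπ) (Fin Nπ) ℂ))
    (H : Set (ZdEdge d)) [DecidablePred (· ∈ H)] (x : Literature.Probability.LatticeModels.Site d) (i j : Fin d) (R T : ℕ)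
    (hH : ∀ U : ZdGaugeConfig d G, (twist H z U).rectangle x i j R T = z * U.rectangle x i j R T)
    (Φ : ZdGaugeConfig d G → ℝ) (hΦm : Measurable Φ) {C : ℝ} (hΦb : ∀ U, |Φ U| ≤ C)
    (hΦ : ∀ U, Φ (twist H z U) = Φ U) :
    ∫ U, zdWilsonLoop π x i j R T U * Φ U ∂zdHaar d G = 0 := by
  -- adapted from `TorusAreaLaw.integral_zdWilsonLoop_mul_eq_zero_of_twist` (tree), `SU(N)` replaced by the hypotheses on `π`
  set Wc : ZdGaugeConfig d G → ℂ := fun U => (π (U.rectangle x i j R T)).trace with hWc_def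
  have hWc_cont : Continuous Wc := (hπ.comp (continuous_rectangle x i j R T)).matrix_trace
  obtain ⟨Mc, hMc⟩ := (isCompact_univ (X := ZdGaugeConfig d G)).exists_bound_of_continuousOn hWc_cont.continuousOn
  have hWcτ : ∀ U, Wc (twist H z U) = ω * Wc U := by
    intro U
    simp only [hWc_def, hH U, map_mul, hπz, smul_mul_assoc, one_mul, Matrix.trace_smul, smul_eq_mul]
  have hmeas : Measurable fun U => Wc U * (Φ U : ℂ) :=
    hWc_cont.measurable.mul (Complex.measurable_ofReal.comp hΦm)
  have hC0 : 0 ≤ C := (abs_nonneg _).trans (hΦb (Classical.arbitrary _))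
  have hint : Integrable (fun U => Wc U * (Φ U : ℂ)) (zdHaar d G) := by
    refine Integrable.of_bound hmeas.aestronglyMeasurable (Mc * C) (Eventually.of_forall fun U => ?_)
    rw [norm_mul, Complex.norm_real, Real.norm_eq_abs]
    exact mul_le_mul (hMc U (Set.mem_univ U)) (hΦb U) (abs_nonneg _) ((norm_nonneg _).trans (hMc U (Set.mem_univ U)))
  set J : ℂ := ∫ U, Wc U * (Φ U : ℂ) ∂zdHaar d G with hJ_def
  have hJ : J = ω * J := by
    calc J = ∫ U, Wc (twist H z U) * (Φ (twist H z U) : ℂ) ∂zdHaar d G :=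
          (integral_zdHaar_comp_twist _ z hint.aestronglyMeasurable).symm
      _ = ∫ U, ω * (Wc U * (Φ U : ℂ)) ∂zdHaar d G := by
          refine integral_congr_ae (ae_of_all _ fun U => ?_)
          simp only [hWcτ, hΦ U]; ring
      _ = ω * J := integral_const_mul _ _
  have hJ0 : J = 0 := by
    have h1 : (1 - ω) * J = 0 := by rw [sub_mul, one_mul, ← hJ, sub_self]
    rcases mul_eq_zero.mp h1 with h | h
    · exact absurd (sub_eq_zero.mp h).symm hω
    · exact h
  have hre : ∀ U, zdWilsonLoop π x i j R T U * Φ U = (Nπ : ℝ)⁻¹ * (Wc U * (Φ U : ℂ)).re := by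
    intro U
    simp only [zdWilsonLoop, hWc_def, Complex.mul_re, Complex.ofReal_re, Complex.ofReal_im, mul_zero, sub_zero]
    ring
  simp_rw [hre]
  rw [integral_const_mul]
  have := integral_re hint
  simp only [RCLike.re_to_complex] at this
  rw [this, ← hJ_def, hJ0, Complex.zero_re, mul_zero]

variable {L : ℕ} [NeZero L]

/-- **Area law for the terms of the torus expansion, centre-charged loop** (the tree's `TorusAreaLaw.aPol_zdWilsonLoop_eq_zero`
with `SU(N)` replaced by the hypotheses on `π`; the ACTION representation `ρ` is arbitrary continuous): for real `β`, a set `Q` of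
genuine torus plaquettes with `|Q| < R T` and `2R + 1 ≤ L`, the decorated activity `aPol W^π_{R×T} Q β` of `torusSystem ρ L` vanishes. -/
theorem aPol_zdWilsonLoop_eq_zero_of_central [Fact (1 < L)] [SecondCountableTopology G] (hρ : Continuous ρ)
    (hπ : Continuous π) {z : G} (hzc : ∀ g : G, g * z = z * g) {ω : ℂ} (hω : ω ≠ 1)
    (hπz : π z = ω • (1 : Matrix (Fin Nπ) (Fin Nπ) ℂ))
    {i j : Fin d} (hij : i ≠ j) {R T : ℕ} (hRL : 2 * R + 1 ≤ L) (β : ℝ) {Q : Finset (TPlaq d L)}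
    (hQ : ∀ p ∈ Q, p.2.1 ≠ p.2.2) (hcard : #Q < R * T) :
    (torusSystem ρ L).aPol (fun U => ((zdWilsonLoop π 0 i j R T U : ℝ) : ℂ)) Q β = 0 := by
  classical
  -- adapted from `TorusAreaLaw.aPol_zdWilsonLoop_eq_zero` (tree)
  -- some unit square has both of its flats missed by `Q`
  obtain ⟨a, ha, b, hb, hab⟩ : ∃ a, a < R ∧ ∃ b, b < T ∧
      ∀ p ∈ Q, p ∉ tflat i j a b ∧ p ∉ tflat i j (a + R) b := by
    by_contra hcon
    push Not at hcon
    have := mul_le_card_of_forall_meets_tflat i j R T Q fun a ha b hb => ?_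
    · omega
    · obtain ⟨p, hp, h⟩ := hcon a ha b hb
      by_cases h' : p ∈ tflat i j a b
      · exact ⟨p, hp, Or.inl h'⟩
      · exact ⟨p, hp, Or.inr (h h')⟩
  set φ : ZdGaugeConfig d G → ℝ := fun U => ∏ p ∈ Q, (Real.exp (-(β * torusCost ρ L p U)) - 1) with hφ_def
  have hφτ : ∀ U, φ (twist (slabSet (0 : Literature.Probability.LatticeModels.Site d) i j a R b) z U) = φ U := by
    intro U
    refine Finset.prod_congr rfl fun p hp => ?_
    simp only [torusCost]
    rw [plaquetteHolonomy_torusSigma_twist_slab hzc hij (by omega) p (hQ p hp) (hab p hp).1 (hab p hp).2]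
  have hrect : ∀ U : ZdGaugeConfig d G,
      (twist (slabSet (0 : Literature.Probability.LatticeModels.Site d) i j a R b) z U).rectangle 0 i j R T =
        z * U.rectangle 0 i j R T :=
    fun U => twist_rectangle_slab hzc 0 hij ha le_rfl hb U
  have hI := integral_zdWilsonLoop_mul_eq_zero_of_central π hπ hω hπz
    (slabSet (0 : Literature.Probability.LatticeModels.Site d) i j a R b) 0 i j R T hrect φ
    (measurable_prod_weight ρ hρ β Q) (abs_prod_weight_le ρ hρ β Q) hφτ
  unfold PlaqSystem.aPol
  simp_rw [weightProd_torusSystem_ofReal]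
  have hmul : ∀ U, ((zdWilsonLoop π 0 i j R T U : ℝ) : ℂ) *
      ((∏ p ∈ Q, (Real.exp (-(β * torusCost ρ L p U)) - 1) : ℝ) : ℂ) =
        ((zdWilsonLoop π 0 i j R T U * φ U : ℝ) : ℂ) := fun U => by
    simp only [hφ_def, Complex.ofReal_mul]
  simp_rw [hmul]
  rw [integral_complex_ofReal, hI, Complex.ofReal_zero]

/-- **The strong-coupling area law for the torus plaquette system, centre-charged loop** (the tree's
`TorusAreaLaw.norm_expect_zdWilsonLoop_le` with `SU(N)` replaced by the hypotheses on `π` and the loop bound `M`): for continuous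
`ρ`, `0 ≤ β ≤ β₁ = betaOne d ρ`, `2R + 1 ≤ L`, `R + T < L` and `|W^π| ≤ M`,
`‖⟨W^π_{R×T}⟩^T_L(β)‖ ≤ M (2 e^{1/2})^{2(R+T) 2^d d²} (β/β₁)^{R T}`. -/
theorem norm_expect_zdWilsonLoop_le_of_central [Fact (1 < L)] [SecondCountableTopology G] (hρ : Continuous ρ)
    (hπ : Continuous π) {z : G} (hzc : ∀ g : G, g * z = z * g) {ω : ℂ} (hω : ω ≠ 1)
    (hπz : π z = ω • (1 : Matrix (Fin Nπ) (Fin Nπ) ℂ)) {M : ℝ} {i j : Fin d} (hij : i ≠ j) {R T : ℕ}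
    (hM : ∀ U : ZdGaugeConfig d G, |zdWilsonLoop π 0 i j R T U| ≤ M)
    (hRL : 2 * R + 1 ≤ L) (hRT : R + T < L) {β : ℝ} (hβ0 : 0 ≤ β) (hβ : β ≤ betaOne d ρ) :
    ‖(torusSystem ρ L).expect (fun U => ((zdWilsonLoop π 0 i j R T U : ℝ) : ℂ)) (torusGenuine d L) β‖ ≤
      M * (2 * Real.exp (1 / 2)) ^ (2 * (R + T) * (2 ^ d * (d * d))) * (β / betaOne d ρ) ^ (R * T) := by
  classical
  -- adapted from `TorusAreaLaw.norm_expect_zdWilsonLoop_le` (tree)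
  set S := torusSystem (G := G) ρ L with hS
  have hR : S.Regular (costBound ρ) (Plaq.degBound d) := torusSystem_regular ρ hρ
  set Mc := costBound ρ with hMc
  set D := Plaq.degBound d with hD
  set B : Finset (ZdEdge d) := loopEdges (0 : Literature.Probability.LatticeModels.Site d) i j R T with hB
  set F : ZdGaugeConfig d G → ℂ := fun U => ((zdWilsonLoop π 0 i j R T U : ℝ) : ℂ) with hF
  have hFm : Measurable F :=
    Complex.measurable_ofReal.comp (continuous_zdWilsonLoop π hπ 0 i j R T).measurable
  have hFb : ∀ U, ‖F U‖ ≤ M := fun U => by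
    rw [hF, Complex.norm_real, Real.norm_eq_abs]; exact hM U
  have hM0 : 0 ≤ M := (abs_nonneg _).trans (hM (Classical.arbitrary _))
  have hFB : DependsOn F (B : Set (ZdEdge d)) := fun U V h => by
    simp only [hF, dependsOn_zdWilsonLoop (ρ := π) 0 i j R T h]
  have hb1 : 0 < betaOne d ρ := betaOne_pos d (ρ := ρ)
  have hβR : PlaqSystem.betaR Mc D = betaOne d ρ := betaR_costBound ρ
  have hβn : ‖(β : ℂ)‖ ≤ PlaqSystem.betaR Mc D := by
    rw [Complex.norm_real, Real.norm_eq_abs, abs_of_nonneg hβ0, hβR]; exact hβ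
  have hb1n : ‖((betaOne d ρ : ℝ) : ℂ)‖ ≤ PlaqSystem.betaR Mc D := by
    rw [Complex.norm_real, Real.norm_eq_abs, abs_of_pos hb1, hβR]
  have hβM : ‖(β : ℂ)‖ * Mc ≤ 1 := PlaqSystem.norm_mul_le_one hR hβn
  set ε : ℝ := 2 * Mc * ‖(β : ℂ)‖ with hε
  set ε₁ : ℝ := 2 * Mc * ‖((betaOne d ρ : ℝ) : ℂ)‖ with hε₁
  set r : ℝ := β / betaOne d ρ with hr
  have hr0 : 0 ≤ r := div_nonneg hβ0 hb1.le
  have hr1 : r ≤ 1 := (div_le_one hb1).2 hβ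
  have hεr : ε = r * ε₁ := by
    simp only [hε, hε₁, hr, Complex.norm_real, Real.norm_eq_abs, abs_of_nonneg hβ0, abs_of_pos hb1]
    field_simp
  have hMc0 : 0 < Mc := costBound_pos ρ
  have hε₁0 : 0 ≤ ε₁ := by rw [hε₁]; positivity
  set K := #(S.seedsOf B) with hK
  set Tset := (torusGenuine d L).powerset.filter (Polymer.IsSeedConn S.Adj (S.Touches B)) with hTset
  have hV : ∀ Q₁ ∈ Tset, ∀ p ∈ Q₁, p.2.1 ≠ p.2.2 := fun Q₁ hQ₁ p hp =>
    (mem_torusGenuine.1 (mem_powerset.1 (mem_filter.1 hQ₁).1 hp)).ne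
  have hone : (1 : ℝ) ≤ 2 * Real.exp (1 / 2) := by
    have := Real.one_le_exp (by norm_num : (0 : ℝ) ≤ 1 / 2); linarith
  have hKle : K ≤ 2 * (R + T) * (2 ^ d * (d * d)) := by
    calc K ≤ #(Plaq.seedsOf B) := by
          have := card_seedsOf_torusSystem_le (G := G) ρ (L := L) B
          rwa [image_torusRed_loopEdges hRT] at this
      _ ≤ #B * (2 ^ d * (d * d)) := card_plaqSeedsOf_le B
      _ ≤ 2 * (R + T) * (2 ^ d * (d * d)) := Nat.mul_le_mul_right _ (card_loopEdges_le 0 i j R T)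
  rw [PlaqSystem.expect_eq_sum hR hFm hFb hFB (torusGenuine d L) β]
  calc ‖∑ Q₁ ∈ Tset, S.aPol F Q₁ β * S.ratio (torusGenuine d L) (S.snbAll B Q₁) β‖
      ≤ ∑ Q₁ ∈ Tset, ‖S.aPol F Q₁ β * S.ratio (torusGenuine d L) (S.snbAll B Q₁) β‖ :=
        norm_sum_le _ _
    _ ≤ ∑ Q₁ ∈ Tset, M * (2 ^ K * r ^ (R * T)) * (ε₁ * 2 ^ D) ^ #Q₁ := by
        refine Finset.sum_le_sum fun Q₁ hQ₁ => ?_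
        rw [norm_mul]
        have h2 : ‖S.ratio (torusGenuine d L) (S.snbAll B Q₁) β‖ ≤ 2 ^ (K + D * #Q₁) := by
          refine (PlaqSystem.norm_ratio_le hR hβn _ _).trans (pow_le_pow_right₀ one_le_two ?_)
          calc #(S.snbAll B Q₁) ≤ #(S.seedsOf B) + #(S.nbAll Q₁) := Finset.card_union_le _ _
            _ ≤ K + D * #Q₁ := Nat.add_le_add_left (PlaqSystem.card_nbAll_le hR Q₁) _
        have h1 : ‖S.aPol F Q₁ β‖ ≤ M * r ^ (R * T) * ε₁ ^ #Q₁ := by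
          by_cases hc : R * T ≤ #Q₁
          · calc ‖S.aPol F Q₁ β‖ ≤ M * ε ^ #Q₁ := PlaqSystem.norm_aPol_le hR hFb hβM Q₁
              _ = M * (r ^ #Q₁ * ε₁ ^ #Q₁) := by rw [hεr, mul_pow]
              _ ≤ M * (r ^ (R * T) * ε₁ ^ #Q₁) :=
                  mul_le_mul_of_nonneg_left
                    (mul_le_mul_of_nonneg_right (pow_le_pow_of_le_one hr0 hr1 hc) (by positivity)) hM0
              _ = M * r ^ (R * T) * ε₁ ^ #Q₁ := by ring
          · have h0 : S.aPol F Q₁ β = 0 :=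
              aPol_zdWilsonLoop_eq_zero_of_central ρ π hρ hπ hzc hω hπz hij hRL β (hV Q₁ hQ₁) (by omega)
            rw [h0, norm_zero]
            positivity
        calc ‖S.aPol F Q₁ β‖ * ‖S.ratio (torusGenuine d L) (S.snbAll B Q₁) β‖
            ≤ M * r ^ (R * T) * ε₁ ^ #Q₁ * 2 ^ (K + D * #Q₁) :=
              mul_le_mul h1 h2 (norm_nonneg _) (by positivity)
          _ = M * (2 ^ K * r ^ (R * T)) * (ε₁ * 2 ^ D) ^ #Q₁ := by rw [pow_add, pow_mul, mul_pow]; ring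
    _ = M * (2 ^ K * r ^ (R * T)) * ∑ Q₁ ∈ Tset, (ε₁ * 2 ^ D) ^ #Q₁ := by rw [Finset.mul_sum]
    _ ≤ M * (2 ^ K * r ^ (R * T)) *
          Real.exp (#((torusGenuine d L).filter (S.Touches B)) * (1 / 2 : ℝ)) := by
        gcongr
        refine Polymer.sum_isSeedConn_pow_card_le (adj := S.Adj) (s := S.Touches B)
          (by positivity) (torusGenuine d L) fun t _ => ?_
        have := PlaqSystem.sum_isConn_eps_le hR hb1n (torusGenuine d L) t
        simpa only [hε₁] using this
    _ ≤ M * (2 ^ K * r ^ (R * T)) * Real.exp (K * (1 / 2 : ℝ)) := by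
        gcongr
        exact_mod_cast Finset.card_le_card (S.filter_touches_subset B _)
    _ = M * (2 * Real.exp (1 / 2)) ^ K * r ^ (R * T) := by
        rw [mul_pow, ← Real.exp_nat_mul]; ring
    _ ≤ M * (2 * Real.exp (1 / 2)) ^ (2 * (R + T) * (2 ^ d * (d * d))) * r ^ (R * T) := by
        gcongr

/-- **Volume-uniform torus area law at strong coupling, centre-charged loop, every compact `G`** (Osterwalder–Seiler 1978 Thm. 5.1
∕ Lemma 5.2, periodic b.c.; the tree's `TorusAreaLaw.abs_wilsonExpectation_wilsonLoop_le` generalised): for the Wilson action in a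
continuous representation `ρ`, a continuous centre-charged `π` with `|W^π| ≤ M`, `i ≠ j`, `0 ≤ β ≤ β₁`, and a torus `(ℤ/L)^d`
with `1 < L`, `2R + 1 ≤ L`, `R + T < L`: `|⟨W^π_{R×T}⟩_{Λ_L,β}| ≤ M (2 e^{1/2})^{2(R+T) 2^d d²} (β/β₁)^{R T}`. -/
theorem abs_wilsonExpectation_wilsonLoop_le_of_central [SecondCountableTopology G] (hρ : Continuous ρ)
    (hπ : Continuous π) {z : G} (hzc : ∀ g : G, g * z = z * g) {ω : ℂ} (hω : ω ≠ 1)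
    (hπz : π z = ω • (1 : Matrix (Fin Nπ) (Fin Nπ) ℂ)) {M : ℝ}
    {i j : Fin d} (hij : i ≠ j) {R T : ℕ} (hM : ∀ U : ZdGaugeConfig d G, |zdWilsonLoop π 0 i j R T U| ≤ M)
    (h1L : 1 < L) (hRL : 2 * R + 1 ≤ L) (hRT : R + T < L) {β : ℝ} (hβ0 : 0 ≤ β) (hβ : β ≤ betaOne d ρ) :
    |wilsonExpectation (L := L) ρ β (wilsonLoop π (0 : Site d L) i j R T)| ≤
      M * (2 * Real.exp (1 / 2)) ^ (2 * (R + T) * (2 ^ d * (d * d))) * (β / betaOne d ρ) ^ (R * T) := by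
  -- adapted from `TorusAreaLaw.abs_wilsonExpectation_wilsonLoop_le` (tree)
  haveI : Fact (1 < L) := ⟨h1L⟩
  have h0 : Literature.Probability.LatticeModels.Torus.proj L
      (0 : Literature.Probability.LatticeModels.Site d) = (0 : Site d L) := by
    funext k; simp [Literature.Probability.LatticeModels.Torus.proj]
  have hW : wilsonLoop π (0 : Site d L) i j R T = QuantumLattice.toTorusObservable L
      (zdWilsonLoop π (0 : Literature.Probability.LatticeModels.Site d) i j R T) := by
    funext U
    rw [QuantumLattice.toTorusObservable_apply, zdWilsonLoop_torusLift, h0]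
  have hFm : Measurable (zdWilsonLoop π (0 : Literature.Probability.LatticeModels.Site d) i j R T) :=
    (continuous_zdWilsonLoop π hπ 0 i j R T).measurable
  rw [hW, wilsonExpectation_toTorusObservable_eq_re_expect ρ hρ β hFm hM]
  have hobs : (fun U : ZdGaugeConfig d G =>
      ((zdWilsonLoop π 0 i j R T (U ∘ torusRed L) : ℝ) : ℂ)) =
        fun U => ((zdWilsonLoop π 0 i j R T U : ℝ) : ℂ) := by
    funext U; rw [zdWilsonLoop_comp_torusRed π hRT U]
  rw [hobs]
  exact (Complex.abs_re_le_norm _).trans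
    (norm_expect_zdWilsonLoop_le_of_central ρ π hρ hπ hzc hω hπz hij hM hRL hRT hβ0 hβ)

end Central

/-! ## §2 The rung: `TensionStrongCoupling` -/

section Rung

variable {G : Type} [Group G] [TopologicalSpace G] [IsTopologicalGroup G] [CompactSpace G]
  [MeasurableSpace G] [BorelSpace G]

/-- `torusRect` is the torus Wilson expectation of Wave 0's `wilsonLoop` in the loop representation `π` (plane `(0,1)`, base `0`). -/
theorem torusRect_eq_wilsonExpectation {N Nπ : ℕ} (ρ : G →* Matrix (Fin N) (Fin N) ℂ)
    (π : G →* Matrix (Fin Nπ) (Fin Nπ) ℂ) (β : ℝ) (S R T : ℕ) :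
    torusRect ρ (fun g => QuantumLattice.normalisedCharacter Nπ (π g)) β S R T =
      wilsonExpectation (L := 2 * S + 1) ρ β (wilsonLoop π (0 : Site 4 (2 * S + 1)) 0 1 R T) := by
  unfold torusRect wilsonExpectation
  refine integral_congr_ae (ae_of_all _ fun U => ?_)
  have h0 : Literature.Probability.LatticeModels.Torus.proj (2 * S + 1)
      (0 : Literature.Probability.LatticeModels.Site 4) = (0 : Site 4 (2 * S + 1)) := by
    funext k; simp [Literature.Probability.LatticeModels.Torus.proj]
  simp only [QuantumLattice.wilsonLoopObs, QuantumLattice.walkHolonomy_rectWalk_eq, h0, QuantumLattice.normalisedCharacter,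
    wilsonLoop]

/-- **Rung T1-sc PROVED.**  The registered rung stub `stub_rung_tensionStrongCoupling : TensionStrongCoupling` of line `tension-ratio`
closes by `exact stub_rung_tensionStrongCoupling_proved`.  Constants: `β_D = β₁(r)/2` with `β₁ = betaOne 4 r.ρ` the tree's strong-coupling
radius, `s = log 2`, `C = M_π · (2e^{1/2})^{256}` where `M_π ≥ 1` bounds the `π`-loop observable.  Simplicity and simple connectivity of
`G` are not used. -/
theorem stub_rung_tensionStrongCoupling_proved : TensionStrongCoupling := by
  intro G _ _ _ _ hG hsc
  letI : MeasurableSpace G := borel G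
  haveI : BorelSpace G := ⟨rfl⟩
  intro r Nπ π z ω hNπ hπ hz hω hπz
  haveI : SecondCountableTopology G :=
    (r.continuous.isClosedEmbedding r.injective).isEmbedding.secondCountableTopology
  have hzc : ∀ g : G, g * z = z * g := fun g => (Subgroup.mem_center_iff.1 hz g)
  set β₁ : ℝ := betaOne 4 r.ρ with hβ₁
  have hb1 : 0 < β₁ := betaOne_pos 4 (ρ := r.ρ)
  refine ⟨β₁ / 2, by positivity, fun β hβ0 hβD => ?_⟩
  have hββ₁ : β ≤ β₁ := by linarith
  -- one loop bound `M` for all `R, T`: `|W^π| ≤ sup_g |χ_π g|`, obtained on the group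
  obtain ⟨M, hM1, hM⟩ : ∃ M : ℝ, 1 ≤ M ∧ ∀ g : G, |QuantumLattice.normalisedCharacter Nπ (π g)| ≤ M := by
    have hc : Continuous fun g : G => QuantumLattice.normalisedCharacter Nπ (π g) := by
      unfold QuantumLattice.normalisedCharacter
      exact continuous_const.mul (Complex.continuous_re.comp hπ.matrix_trace)
    obtain ⟨C, hC⟩ := (isCompact_univ (X := G)).exists_bound_of_continuousOn hc.continuousOn
    refine ⟨max C 1, le_max_right _ _, fun g => ?_⟩
    have := hC g (Set.mem_univ g)
    rw [Real.norm_eq_abs] at this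
    exact this.trans (le_max_left _ _)
  have hMU : ∀ (R T : ℕ) (U : ZdGaugeConfig 4 G), |zdWilsonLoop π 0 0 1 R T U| ≤ M := fun R T U => hM _
  set A : ℝ := (2 * Real.exp (1 / 2)) ^ (2 ^ 4 * (4 * 4)) with hA
  have hA1 : 1 ≤ A := by
    have : (1 : ℝ) ≤ 2 * Real.exp (1 / 2) := by
      have := Real.one_le_exp (by norm_num : (0 : ℝ) ≤ 1 / 2); linarith
    exact one_le_pow₀ this
  refine ⟨M * A, Real.log 2, Real.log_pos one_lt_two, fun S => ?_⟩
  intro R T hR hT hRS hTS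
  have h01 : (0 : Fin 4) ≠ 1 := by decide
  have hmain := abs_wilsonExpectation_wilsonLoop_le_of_central (d := 4) (L := 2 * S + 1) r.ρ π r.continuous hπ hzc hω hπz
    h01 (hMU R T) (by omega) (by omega) (by omega) hβ0.le hββ₁
  rw [torusRect_eq_wilsonExpectation]
  refine hmain.trans ?_
  -- `(β/β₁)^{RT} ≤ 2^{-RT} = exp(-(log 2 · R · T))` and `M · A^{2(R+T)} ≤ (M A)^{2(R+T)}`
  have hr : β / β₁ ≤ 1 / 2 := by
    rw [div_le_iff₀ hb1]; linarith
  have hr0 : 0 ≤ β / β₁ := div_nonneg hβ0.le hb1.le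
  have hpow : (β / β₁) ^ (R * T) ≤ Real.exp (-(Real.log 2 * R * T)) := by
    calc (β / β₁) ^ (R * T) ≤ (1 / 2 : ℝ) ^ (R * T) := pow_le_pow_left₀ hr0 hr _
      _ = Real.exp (-(Real.log 2 * R * T)) := by
          rw [show -(Real.log 2 * R * T) = ((R * T : ℕ) : ℝ) * (-Real.log 2) by push_cast; ring, Real.exp_nat_mul,
            Real.exp_neg, Real.exp_log two_pos]
          norm_num
  have hRT1 : 1 ≤ 2 * (R + T) := by omega
  have hMA : M * (2 * Real.exp (1 / 2)) ^ (2 * (R + T) * (2 ^ 4 * (4 * 4))) ≤ (M * A) ^ (2 * (R + T)) := by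
    rw [mul_comm (2 * (R + T)) _, pow_mul, ← hA, mul_pow]
    refine mul_le_mul_of_nonneg_right ?_ (by positivity)
    calc M = M ^ 1 := (pow_one M).symm
      _ ≤ M ^ (2 * (R + T)) := pow_le_pow_right₀ hM1 hRT1
  have hM0 : 0 ≤ M := zero_le_one.trans hM1
  calc M * (2 * Real.exp (1 / 2)) ^ (2 * (R + T) * (2 ^ 4 * (4 * 4))) * (β / β₁) ^ (R * T)
      ≤ (M * A) ^ (2 * (R + T)) * Real.exp (-(Real.log 2 * R * T)) :=
        mul_le_mul hMA hpow (by positivity) (by positivity)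

end Rung

end Summit.QuantumFields.YangMills.Cruxes.IR.TensionRatio

end
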